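import Literature.NumberTheory.EllipticCurves.SelmerPInftyRestriction
import Literature.NumberTheory.EllipticCurves.SubgroupSelmer
import HarnessLib

/-!
# T-res (second half), file C: transport of a local restriction map along an isomorphism of
# algebraic closures (cell `b2b-bsdres`, n1011, p17 GEN 4; r2 ROUTE-2 §II.17.7 T-res)

HONEST FRAMING (cell `b2b-bsdres`, verbatim in every file): prove what is provable now; nothing is
booked; no label changes. Infrastructure (Galois cohomology bookkeeping, Serre *Galois Cohomology*
II.§1.1: the maps attached to extensions of embeddings of separable closures); DEFINITIONS (the
transport maps) + THEOREMS; NO Literature fact; no `sorry`.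

Setting. `L/K` algebraic, `W/K` a Weierstrass curve, `E` a `K`-field (a completion `K_v`), `E'` an
`L`-field (a completion `L_w`); embeddings `ι : K̄ →ₐ[K] Ē` (any — the local condition at the place
singled out by `ι`, `WeierstrassCurve.localResOverOfEmb`), `ι₂ : Ē ≃+* Ē'`, `ι' : L̄ →ₐ[L] Ē'` with
`ι' ∘ ι_L = ι₂ ∘ ι` (`ι_L = closureEmb L`); subgroups `H ≤ Γ_K`, `H' ≤ Γ_L` with
`resGal L ⁻¹(H) ≤ H'`; the hypothesis `hfix` that every `h ∈ Γ_E` restricting into `H` fixes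
`ι₂⁻¹(E')`. Then: `transportHom` is the continuous homomorphism `θ = ι₂ (·) ι₂⁻¹ : H_ι → H'_{ι'}`
(`resGal L ∘ res_{ι'} ∘ θ = res_ι`), `transportPoints` the `θ`-equivariant coefficient map
`(ι₂⁻¹)_* : E_L(Ē') → E(Ē)`, and `localResOverOfEmb_resH1Hom_eq_zero` the TRANSFER: if
`x ∈ H¹(H', E_L[p^∞])` dies under the local restriction at `ι'`, its image under the map of the pair
`(Θ, E_L[p^∞] ≃ E[p^∞])` (`Θ` a continuous section of `resGal L`; p01's `kerH1Iso` for `H = ker κ`,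
`H' = ker κ_n`) dies under the local restriction at `ι` (`resH1Hom_comp`, `resH1Hom_congr`).
File D supplies `ι₂`, `ι'`, `hfix` at finite places (`E = K_v`, `E' = L_w`, files A/B).

References: [SerreGaloisCohomology1997] I.§2.4, II.§1.1; [GreenbergLNM1716] §2.
-/

noncomputable section

open scoped Classical

open Literature.NumberTheory.EllipticCurves

universe u

namespace Summit.BirchSwinnertonDyer.Rank1Residual.Additive.LocalTransport

variable {K : Type u} [Field K] (L : Type u) [Field L] [Algebra K L]
variable {E : Type u} [Field E] [Algebra K E]
variable {E' : Type u} [Field E'] [Algebra L E']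


section Aut

variable (ι₂ : AlgebraicClosure E ≃+* AlgebraicClosure E')

/-- `ι₂ h ι₂⁻¹ ∈ Γ_{E'} = Aut(Ē'/E')` for `h ∈ Γ_E` fixing `ι₂⁻¹(E')` pointwise.
[cite: SerreGaloisCohomology1997, II.§1.1] -/
def transportAut (h : Field.absoluteGaloisGroup E)
    (hh : ∀ y : E', (show AlgebraicClosure E ≃ₐ[E] AlgebraicClosure E from h)
      (ι₂.symm (algebraMap E' (AlgebraicClosure E') y)) =
        ι₂.symm (algebraMap E' (AlgebraicClosure E') y)) :
    Field.absoluteGaloisGroup E' :=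
  show AlgebraicClosure E' ≃ₐ[E'] AlgebraicClosure E' from
  { ι₂.symm.trans (((show AlgebraicClosure E ≃ₐ[E] AlgebraicClosure E from h) :
        AlgebraicClosure E ≃+* AlgebraicClosure E).trans ι₂) with
    commutes' := fun y ↦ by
      change ι₂ ((show AlgebraicClosure E ≃ₐ[E] AlgebraicClosure E from h) (ι₂.symm _)) = _
      rw [hh y, RingEquiv.apply_symm_apply] }

/-- Values of `transportAut`: `(ι₂ h ι₂⁻¹)(x) = ι₂ (h (ι₂⁻¹ x))`. [folklore] -/
@[simp]
theorem transportAut_apply (h : Field.absoluteGaloisGroup E) (hh) (x : AlgebraicClosure E') :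
    (show AlgebraicClosure E' ≃ₐ[E'] AlgebraicClosure E' from transportAut ι₂ h hh) x =
      ι₂ ((show AlgebraicClosure E ≃ₐ[E] AlgebraicClosure E from h) (ι₂.symm x)) :=
  rfl

end Aut


section Emb

variable [Algebra.IsAlgebraic K L]
variable (ι : AlgebraicClosure K →ₐ[K] AlgebraicClosure E)
  (ι₂ : AlgebraicClosure E ≃+* AlgebraicClosure E')
  (ι' : AlgebraicClosure L →ₐ[L] AlgebraicClosure E')
  (hcompat : ∀ z : AlgebraicClosure K, ι' (closureEmb (K := K) L z) = ι₂ (ι z))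

include hcompat in
/-- **The restrictions match**: `resGal L (res_{ι'} (ι₂ h ι₂⁻¹)) = res_ι h` (all maps are
characterised by `emb ∘ res σ = σ ∘ emb`; `ι' ∘ ι_L = ι₂ ∘ ι`). [cite: SerreGaloisCohomology1997, II.§1.1] -/
theorem resGal_resGalOfEmb_transportAut (h : Field.absoluteGaloisGroup E) (hh) :
    resGal (K := K) L (resGalOfEmb (K := L) ι' (transportAut ι₂ h hh)) = resGalOfEmb ι h := by
  apply AlgEquiv.ext
  intro z
  apply ι.injective
  apply ι₂.injective
  have h1 : ι₂ (ι ((show AlgebraicClosure K ≃ₐ[K] AlgebraicClosure K from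
      resGal (K := K) L (resGalOfEmb (K := L) ι' (transportAut ι₂ h hh))) z)) =
      ι' ((show AlgebraicClosure L ≃ₐ[L] AlgebraicClosure L from
        resGalOfEmb (K := L) ι' (transportAut ι₂ h hh)) (closureEmb (K := K) L z)) := by
    rw [← hcompat]
    exact congrArg ι' (algEquivOfEmb_resGal_apply L _ z)
  have h2 : ι' ((show AlgebraicClosure L ≃ₐ[L] AlgebraicClosure L from
        resGalOfEmb (K := L) ι' (transportAut ι₂ h hh)) (closureEmb (K := K) L z)) =
      (show AlgebraicClosure E' ≃ₐ[E'] AlgebraicClosure E' from transportAut ι₂ h hh)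
        (ι' (closureEmb (K := K) L z)) :=
    apply_resGalAuxOfEmb_apply ι' (transportAut ι₂ h hh) (closureEmb (K := K) L z)
  have h3 : (show AlgebraicClosure E' ≃ₐ[E'] AlgebraicClosure E' from transportAut ι₂ h hh)
        (ι' (closureEmb (K := K) L z)) =
      ι₂ ((show AlgebraicClosure E ≃ₐ[E] AlgebraicClosure E from h) (ι z)) := by
    rw [transportAut_apply, hcompat, RingEquiv.symm_apply_apply]
  have h4 : ι₂ (ι ((show AlgebraicClosure K ≃ₐ[K] AlgebraicClosure K from resGalOfEmb ι h) z)) =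
      ι₂ ((show AlgebraicClosure E ≃ₐ[E] AlgebraicClosure E from h) (ι z)) :=
    congrArg ι₂ (apply_resGalAuxOfEmb_apply ι h z)
  exact (h1.trans (h2.trans h3)).trans h4.symm

end Emb


section Transport

variable [Algebra.IsAlgebraic K L]
variable (H : Subgroup (Field.absoluteGaloisGroup K)) (H' : Subgroup (Field.absoluteGaloisGroup L))
  (hHH' : ∀ τ : Field.absoluteGaloisGroup L, resGal (K := K) L τ ∈ H → τ ∈ H')
variable (ι : AlgebraicClosure K →ₐ[K] AlgebraicClosure E)
  (ι₂ : AlgebraicClosure E ≃+* AlgebraicClosure E')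
  (ι' : AlgebraicClosure L →ₐ[L] AlgebraicClosure E')
  (hcompat : ∀ z : AlgebraicClosure K, ι' (closureEmb (K := K) L z) = ι₂ (ι z))
  (hfix : ∀ h : Field.absoluteGaloisGroup E, resGalOfEmb ι h ∈ H → ∀ y : E',
    (show AlgebraicClosure E ≃ₐ[E] AlgebraicClosure E from h)
      (ι₂.symm (algebraMap E' (AlgebraicClosure E') y)) =
        ι₂.symm (algebraMap E' (AlgebraicClosure E') y))

/-- The transport `h ↦ ι₂ h ι₂⁻¹` on `H_ι = (res_ι)⁻¹(H) ≤ Γ_E`, as a monoid homomorphism into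
`Γ_{E'}`. [cite: SerreGaloisCohomology1997, II.§1.1] -/
def transportHom₀ : localSubgroupOfEmb H ι →* Field.absoluteGaloisGroup E' where
  toFun h := transportAut ι₂ (h : Field.absoluteGaloisGroup E) (hfix h h.2)
  map_one' := AlgEquiv.ext fun x ↦ ι₂.apply_symm_apply x
  map_mul' h h' := AlgEquiv.ext fun x ↦ by
    change _ = ι₂ ((show AlgebraicClosure E ≃ₐ[E] AlgebraicClosure E from (h : Field.absoluteGaloisGroup E))
        (ι₂.symm (ι₂ ((show AlgebraicClosure E ≃ₐ[E] AlgebraicClosure E from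
          (h' : Field.absoluteGaloisGroup E)) (ι₂.symm x)))))
    rw [RingEquiv.symm_apply_apply]
    rfl

omit [Algebra.IsAlgebraic K L] in
/-- Values of `transportHom₀`. [folklore] -/
theorem transportHom₀_apply (h : localSubgroupOfEmb H ι) (x : AlgebraicClosure E') :
    (show AlgebraicClosure E' ≃ₐ[E'] AlgebraicClosure E' from transportHom₀ H ι ι₂ hfix h) x =
      ι₂ ((show AlgebraicClosure E ≃ₐ[E] AlgebraicClosure E from (h : Field.absoluteGaloisGroup E))
        (ι₂.symm x)) :=
  rfl

/-- **`h ↦ ι₂ h ι₂⁻¹` is Krull-continuous**: the preimage of the fixing group of a finite `F'/E'`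
contains the trace on `H_ι` of the fixing group of `E(ι₂⁻¹ bᵢ)`, `bᵢ` an `E'`-basis of `F'`
(cf. the tree's `continuous_resGalAuxOfEmb`). [cite: SerreGaloisCohomology1997, II.§1.1] -/
theorem continuous_transportHom₀ : Continuous (transportHom₀ H ι ι₂ hfix) := by
  apply continuous_of_continuousAt_one _ (continuousAt_def.mpr _)
  intro N hN
  rw [map_one] at hN
  obtain ⟨F', hfd, hO⟩ := (krullTopology_mem_nhds_one_iff E' (AlgebraicClosure E') N).mp hN
  let b := Module.finBasis E' F'
  let S : Set (AlgebraicClosure E) := Set.range fun i ↦ ι₂.symm ((b i : F') : AlgebraicClosure E')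
  have hSfd : FiniteDimensional E (IntermediateField.adjoin E S) :=
    IntermediateField.finiteDimensional_adjoin fun x _ ↦ Algebra.IsIntegral.isIntegral x
  have hU : ((IntermediateField.adjoin E S).fixingSubgroup :
      Set (AlgebraicClosure E ≃ₐ[E] AlgebraicClosure E)) ∈ nhds (1 : Field.absoluteGaloisGroup E) :=
    (krullTopology_mem_nhds_one_iff E (AlgebraicClosure E) _).mpr ⟨_, hSfd, subset_rfl⟩
  have hU' : (Subtype.val : localSubgroupOfEmb H ι → Field.absoluteGaloisGroup E) ⁻¹'
      ((IntermediateField.adjoin E S).fixingSubgroup :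
        Set (AlgebraicClosure E ≃ₐ[E] AlgebraicClosure E)) ∈ nhds (1 : localSubgroupOfEmb H ι) :=
    continuous_subtype_val.continuousAt.preimage_mem_nhds hU
  refine Filter.mem_of_superset hU' fun h hh ↦ ?_
  apply hO
  have hh' : (show AlgebraicClosure E ≃ₐ[E] AlgebraicClosure E from
      (h : Field.absoluteGaloisGroup E)) ∈ (IntermediateField.adjoin E S).fixingSubgroup := hh
  rw [IntermediateField.mem_fixingSubgroup_iff] at hh'
  change (show AlgebraicClosure E' ≃ₐ[E'] AlgebraicClosure E' from transportHom₀ H ι ι₂ hfix h) ∈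
    F'.fixingSubgroup
  rw [IntermediateField.mem_fixingSubgroup_iff]
  intro y hy
  have key : ∀ i, (show AlgebraicClosure E' ≃ₐ[E'] AlgebraicClosure E' from
      transportHom₀ H ι ι₂ hfix h) (b i) = b i := fun i ↦ by
    have hfixes : (show AlgebraicClosure E ≃ₐ[E] AlgebraicClosure E from
        (h : Field.absoluteGaloisGroup E)) (ι₂.symm ((b i : F') : AlgebraicClosure E')) =
        ι₂.symm ((b i : F') : AlgebraicClosure E') :=
      hh' _ (IntermediateField.subset_adjoin E S ⟨i, rfl⟩)
    rw [transportHom₀_apply, hfixes, RingEquiv.apply_symm_apply]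
  have := b.ext
    (f₁ := (show AlgebraicClosure E' ≃ₐ[E'] AlgebraicClosure E' from
      transportHom₀ H ι ι₂ hfix h).toLinearMap ∘ₗ F'.val.toLinearMap)
    (f₂ := F'.val.toLinearMap) (fun i ↦ by simpa using key i)
  exact congr($this ⟨y, hy⟩)

include hHH' hcompat in
/-- `ι₂ h ι₂⁻¹` restricts into `H'` for `h ∈ H_ι`. [cite: SerreGaloisCohomology1997, II.§1.1] -/
theorem transportHom₀_mem (h : localSubgroupOfEmb H ι) :
    transportHom₀ H ι ι₂ hfix h ∈ localSubgroupOfEmb H' ι' := by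
  rw [mem_localSubgroupOfEmb_iff]
  apply hHH'
  change resGal (K := K) L (resGalOfEmb (K := L) ι'
    (transportAut ι₂ (h : Field.absoluteGaloisGroup E) (hfix h h.2))) ∈ H
  rw [resGal_resGalOfEmb_transportAut L ι ι₂ ι' hcompat]
  exact h.2

/-- **The transport `θ : H_ι → H'_{ι'}`**, continuous. [cite: SerreGaloisCohomology1997, II.§1.1] -/
def transportHom : localSubgroupOfEmb H ι →ₜ* localSubgroupOfEmb H' ι' where
  toFun h := ⟨transportHom₀ H ι ι₂ hfix h, transportHom₀_mem L H H' hHH' ι ι₂ ι' hcompat hfix h⟩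
  map_one' := Subtype.ext (map_one _)
  map_mul' h h' := Subtype.ext (map_mul _ h h')
  continuous_toFun := (continuous_transportHom₀ H ι ι₂ hfix).subtype_mk _

/-- Values of `transportHom` in `Γ_{E'}`. [folklore] -/
@[simp]
theorem coe_transportHom_apply (h : localSubgroupOfEmb H ι) :
    ((transportHom L H H' hHH' ι ι₂ ι' hcompat hfix h : localSubgroupOfEmb H' ι') :
      Field.absoluteGaloisGroup E') = transportHom₀ H ι ι₂ hfix h :=
  rfl

/-- **Group identity** `res_{ι'} ∘ θ = Θ ∘ res_ι` for a continuous section `Θ : H → H'` of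
`resGal L` (`resGal L` is injective). [cite: SerreGaloisCohomology1997, II.§1.1] -/
theorem resGalSubgroupOfEmb_comp_transportHom (Θ : H →ₜ* H')
    (hΘ : ∀ τ : H, resGal (K := K) L (Θ τ : Field.absoluteGaloisGroup L) = τ) :
    (resGalSubgroupOfEmb H' ι').comp (transportHom L H H' hHH' ι ι₂ ι' hcompat hfix) =
      Θ.comp (resGalSubgroupOfEmb H ι) := by
  apply ContinuousMonoidHom.ext
  intro h
  apply Subtype.ext
  apply resGal_injective (K := K) L
  rw [ContinuousMonoidHom.comp_toFun, ContinuousMonoidHom.comp_toFun, hΘ,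
    resGalSubgroupOfEmb_apply_coe, resGalSubgroupOfEmb_apply_coe, coe_transportHom_apply]
  exact resGal_resGalOfEmb_transportAut L ι ι₂ ι' hcompat (h : Field.absoluteGaloisGroup E)
    (hfix h h.2)


variable [Algebra K E'] [IsScalarTower K L E']

omit [Algebra.IsAlgebraic K L] in
include hcompat in
/-- `ι₂` is `K`-linear (from `ι' ∘ ι_L = ι₂ ∘ ι` at `K`). [folklore] -/
theorem map_algebraMap_of_compat (x : K) :
    ι₂ (algebraMap K (AlgebraicClosure E) x) = algebraMap K (AlgebraicClosure E') x := by
  rw [← ι.commutes x, ← hcompat, (closureEmb (K := K) L).commutes x,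
    IsScalarTower.algebraMap_apply K L (AlgebraicClosure L), ι'.commutes,
    ← IsScalarTower.algebraMap_apply]

/-- `ι₂` as a `K`-algebra isomorphism `Ē ≃ₐ[K] Ē'`. [folklore] -/
def algEquivOfCompat : AlgebraicClosure E ≃ₐ[K] AlgebraicClosure E' :=
  { ι₂ with commutes' := map_algebraMap_of_compat L ι ι₂ ι' hcompat }

omit [Algebra.IsAlgebraic K L] in
/-- `algEquivOfCompat` is `ι₂`. [folklore] -/
@[simp]
theorem algEquivOfCompat_apply (x : AlgebraicClosure E) :
    algEquivOfCompat L ι ι₂ ι' hcompat x = ι₂ x :=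
  rfl

omit [Algebra.IsAlgebraic K L] in
/-- `algEquivOfCompat⁻¹` is `ι₂⁻¹`. [folklore] -/
@[simp]
theorem algEquivOfCompat_symm_apply (x : AlgebraicClosure E') :
    (algEquivOfCompat L ι ι₂ ι' hcompat).symm x = ι₂.symm x :=
  rfl

variable (W : WeierstrassCurve K)

/-- **`ψ = (ι₂⁻¹)_* : E_L(Ē') → E(Ē)`** (`pointsCongr`, then coordinates by `ι₂⁻¹`).
[cite: SerreGaloisCohomology1997, II.§1.1] -/
def transportPoints : localPoints (W.baseChange L) E' →+ localPoints W E :=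
  (WeierstrassCurve.Affine.Point.map
      ((algEquivOfCompat L ι ι₂ ι' hcompat).symm :
        AlgebraicClosure E' →ₐ[K] AlgebraicClosure E)).comp
    (pointsCongr W L (AlgebraicClosure E')).symm.toAddMonoidHom

omit [Algebra.IsAlgebraic K L] in
/-- Unfolding `transportPoints`. [folklore] -/
theorem transportPoints_apply (P : localPoints (W.baseChange L) E') :
    transportPoints L ι ι₂ ι' hcompat W P =
      WeierstrassCurve.Affine.Point.map
        ((algEquivOfCompat L ι ι₂ ι' hcompat).symm :
          AlgebraicClosure E' →ₐ[K] AlgebraicClosure E)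
        ((pointsCongr W L (AlgebraicClosure E')).symm
          (show ((W.baseChange L).baseChange (AlgebraicClosure E')).toAffine.Point from P)) :=
  rfl

omit [Algebra.IsAlgebraic K L] in
/-- `pointsCongr⁻¹` is natural in `L`-algebra maps (from `pointsCongr_map`). [folklore] -/
theorem pointsCongr_symm_map {Ω : Type u} [Field Ω] [Algebra K Ω] [Algebra L Ω]
    [IsScalarTower K L Ω] {Ω' : Type u} [Field Ω'] [Algebra K Ω'] [Algebra L Ω']
    [IsScalarTower K L Ω'] (f : Ω →ₐ[L] Ω')
    (Q : ((W.baseChange L).baseChange Ω).toAffine.Point) :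
    (pointsCongr W L Ω').symm (WeierstrassCurve.Affine.Point.map f Q) =
      WeierstrassCurve.Affine.Point.map (f.restrictScalars K) ((pointsCongr W L Ω).symm Q) := by
  apply (pointsCongr W L Ω').injective
  rw [AddEquiv.apply_symm_apply, pointsCongr_map, AddEquiv.apply_symm_apply]

/-- **`ψ` is `θ`-equivariant**: `ψ ((ι₂ h ι₂⁻¹) • P) = h • ψ P`.
[cite: SerreGaloisCohomology1997, I.§2.4] -/
theorem transportPoints_smul (h : localSubgroupOfEmb H ι) (P : localPoints (W.baseChange L) E') :
    transportPoints L ι ι₂ ι' hcompat W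
        (transportHom L H H' hHH' ι ι₂ ι' hcompat hfix h • P) =
      h • transportPoints L ι ι₂ ι' hcompat W P := by
  rw [Subgroup.smul_def, Subgroup.smul_def, localPoints.smul_def, localPoints.smul_def,
    transportPoints_apply, transportPoints_apply, coe_transportHom_apply]
  change WeierstrassCurve.Affine.Point.map _ ((pointsCongr W L (AlgebraicClosure E')).symm
      (WeierstrassCurve.Affine.Point.map _ _)) = _
  rw [pointsCongr_symm_map, WeierstrassCurve.Affine.Point.map_map,
    WeierstrassCurve.Affine.Point.map_map]
  have hF : ((algEquivOfCompat L ι ι₂ ι' hcompat).symm :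
        AlgebraicClosure E' →ₐ[K] AlgebraicClosure E).comp
      (((show AlgebraicClosure E' ≃ₐ[E'] AlgebraicClosure E' from
          transportHom₀ H ι ι₂ hfix h).restrictScalars L).restrictScalars K :
        AlgebraicClosure E' →ₐ[K] AlgebraicClosure E') =
      ((AlgEquiv.restrictScalars K (show AlgebraicClosure E ≃ₐ[E] AlgebraicClosure E from
          (h : Field.absoluteGaloisGroup E)) :
            AlgebraicClosure E ≃ₐ[K] AlgebraicClosure E) :
          AlgebraicClosure E →ₐ[K] AlgebraicClosure E).comp
        ((algEquivOfCompat L ι ι₂ ι' hcompat).symm :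
          AlgebraicClosure E' →ₐ[K] AlgebraicClosure E) := by
    apply AlgHom.ext
    intro x
    change ι₂.symm (ι₂ ((show AlgebraicClosure E ≃ₐ[E] AlgebraicClosure E from
        (h : Field.absoluteGaloisGroup E)) (ι₂.symm x))) =
      (show AlgebraicClosure E ≃ₐ[E] AlgebraicClosure E from (h : Field.absoluteGaloisGroup E))
        (ι₂.symm x)
    rw [RingEquiv.symm_apply_apply]
  exact congrArg (fun F ↦ WeierstrassCurve.Affine.Point.map F _) hF

variable (p : ℕ)

/-- **Coefficient identity** `ψ ∘ (ι')_* ∘ (E[p^∞] ≃ E_L[p^∞]) = ι_*` (`ι₂⁻¹ ∘ ι' ∘ ι_L = ι`).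
[cite: SerreGaloisCohomology1997, II.§1.1] -/
theorem transportPoints_pointsMapOfEmb (P : W.geomPrimaryTorsion p) :
    transportPoints L ι ι₂ ι' hcompat W
        (pointsMapOfEmb (W.baseChange L) ι'
          ((primaryBaseChangeEquiv L W p P : (W.baseChange L).geomPrimaryTorsion p) :
            WeierstrassCurve.geomPoints (W.baseChange L))) =
      pointsMapOfEmb W ι (P : WeierstrassCurve.geomPoints W) := by
  rw [primaryBaseChangeEquiv_apply, coe_primaryBaseChangeMap, transportPoints_apply]
  change WeierstrassCurve.Affine.Point.map _ ((pointsCongr W L (AlgebraicClosure E')).symm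
    (WeierstrassCurve.Affine.Point.map ι' (pointsCongr W L (AlgebraicClosure L)
      (WeierstrassCurve.Affine.Point.map (closureEmb (K := K) L)
        (show (W.baseChange (AlgebraicClosure K)).toAffine.Point from
          (P : WeierstrassCurve.geomPoints W)))))) =
    WeierstrassCurve.Affine.Point.map ι
      (show (W.baseChange (AlgebraicClosure K)).toAffine.Point from
        (P : WeierstrassCurve.geomPoints W))
  rw [← pointsCongr_map, AddEquiv.symm_apply_apply, WeierstrassCurve.Affine.Point.map_map,
    WeierstrassCurve.Affine.Point.map_map]
  have hF : (((algEquivOfCompat L ι ι₂ ι' hcompat).symm :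
        AlgebraicClosure E' →ₐ[K] AlgebraicClosure E).comp (ι'.restrictScalars K)).comp
      (closureEmb (K := K) L) = ι := by
    apply AlgHom.ext
    intro z
    change ι₂.symm (ι' (closureEmb (K := K) L z)) = ι z
    rw [hcompat, RingEquiv.symm_apply_apply]
  exact congrArg (fun F ↦ WeierstrassCurve.Affine.Point.map F _) hF


include ι₂ hcompat hfix hHH' in
/-- **Transfer of a local vanishing.** For a continuous section `Θ : H → H'` of `resGal L` with the
compatibility `hΘΨ` of `(Θ, E_L[p^∞] ≃ E[p^∞])` (p01's `kerOfKer` when `H = ker κ`, `H' = ker κ_n`):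
if `x ∈ H¹(H', E_L[p^∞])` dies under the local restriction at `ι'`, its image under the map of that
pair dies under the local restriction at `ι` — both composites `H¹(H', E_L[p^∞]) → H¹(H_ι, E(Ē))`
are induced by the same compatible pair. [cite: SerreGaloisCohomology1997, I.§2.4] -/
theorem localResOverOfEmb_resH1Hom_eq_zero (Θ : H →ₜ* H')
    (hΘ : ∀ τ : H, resGal (K := K) L (Θ τ : Field.absoluteGaloisGroup L) = τ)
    (hΘΨ : ∀ (τ : H) (Q : (W.baseChange L).geomPrimaryTorsion p),
      (primaryBaseChangeEquiv L W p).symm.toAddMonoidHom (Θ τ • Q) =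
        τ • (primaryBaseChangeEquiv L W p).symm.toAddMonoidHom Q)
    (x : (W.baseChange L).subgroupH1 p H')
    (hx : (W.baseChange L).localResOverOfEmb p H' ι' x = 0) :
    W.localResOverOfEmb p H ι
      (resH1Hom Θ (primaryBaseChangeEquiv L W p).symm.toAddMonoidHom hΘΨ x) = 0 := by
  have hθψ : ∀ (h : localSubgroupOfEmb H ι) (P : localPoints (W.baseChange L) E'),
      transportPoints L ι ι₂ ι' hcompat W
          (transportHom L H H' hHH' ι ι₂ ι' hcompat hfix h • P) =
        h • transportPoints L ι ι₂ ι' hcompat W P :=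
    transportPoints_smul L H H' hHH' ι ι₂ ι' hcompat hfix W
  have key : (W.localResOverOfEmb p H ι).comp
      (resH1Hom Θ (primaryBaseChangeEquiv L W p).symm.toAddMonoidHom hΘΨ) =
      (resH1Hom (transportHom L H H' hHH' ι ι₂ ι' hcompat hfix)
        (transportPoints L ι ι₂ ι' hcompat W) hθψ).comp
        ((W.baseChange L).localResOverOfEmb p H' ι') := by
    rw [WeierstrassCurve.localResOverOfEmb, WeierstrassCurve.localResOverOfEmb, resH1Hom_comp,
      resH1Hom_comp]
    refine (resH1Hom_congr
      (resGalSubgroupOfEmb_comp_transportHom L H H' hHH' ι ι₂ ι' hcompat hfix Θ hΘ) ?_ _ _).symm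
    apply AddMonoidHom.ext
    intro Q
    obtain ⟨P, rfl⟩ := (primaryBaseChangeEquiv L W p).surjective Q
    simp only [AddMonoidHom.coe_comp, Function.comp_apply, AddEquiv.coe_toAddMonoidHom,
      AddEquiv.symm_apply_apply, AddSubgroup.coe_subtype]
    exact transportPoints_pointsMapOfEmb L ι ι₂ ι' hcompat W p P
  have := congrArg (fun f ↦ f x) key
  simp only [AddMonoidHom.coe_comp, Function.comp_apply] at this
  rw [this, hx, map_zero]

end Transport

end Summit.BirchSwinnertonDyer.Rank1Residual.Additive.LocalTransport

end
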